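import Literature.NumberTheory.GaloisRepresentations.ContinuousCohomologyCoefficientColimit
import Literature.NumberTheory.IwasawaTheory.Greenberg2016.SpecialisedSpecification
import Literature.NumberTheory.GaloisRepresentations.AbsGaloisGroupCompact
import HarnessLib

/-!
# Greenberg 2016/2010 dictionary: a Selmer datum `(𝐃, 𝓛)` over `K_Σ/K` read through an exhaustive
# directed family of `Gal(K_Σ/K)`-stable submodules `𝐃 = ⋃ N i` — global and local cohomology,
# `P(K, 𝐃)`, `Q_𝓛(K, 𝐃)` and `coker(φ_𝓛)` as unions of their finite-level counterparts (theorems only)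

Topic `NumberTheory/IwasawaTheory/Greenberg2016`; namespace
`Literature.NumberTheory.IwasawaTheory.Greenberg2016`; THEOREMS ONLY (no definition, no named
fact, no `sorry`, no instance).  Lane «SUR-Λ» of cell `bsd-eis` (road memo `SUR-LAMBDA-ROAD-w5g9.md`
§4 brick **B3** = the local twin of B1 and the level book-keeping of §2 (ε)),
`--supports stmt-BirchSwinnertonDyer-19032`.

SETTING (the arena of `SelmerGroupStructure.lean`): `ρ : ContinuousRep (GaloisGroupUnramifiedOutside K S) Λ 𝐃`
on a DISCRETE `Λ`-module `𝐃`, a family `N : ι → Submodule Λ 𝐃` of `Gal(K_Σ/K)`-stable submodules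
(`hN`), DIRECTED (`hdir`) and EXHAUSTIVE (`hex : ∀ d, ∃ i, d ∈ N i`) — in print `N k = 𝐃[𝔪ᵏ]`
(Greenberg 2010 §3–4: "`𝐃 = ⋃ 𝐃[𝔪ᵏ]`", the finite levels through which Poitou–Tate duality is
applied); `ρ_i := ρ.subrepresentation (N i) (hN i)`, the global inclusions
`h_i := Hmap ρ_i ρ (N i).subtypeL _ n : Hⁿ(K_Σ/K, N i) → Hⁿ(K_Σ/K, 𝐃)`, the local ones
`h_{i,v} := Hmap (localRep S ρ_i v) (localRep S ρ v) (N i).subtypeL _ n`, transitions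
`Hmap ρ_i ρ_j ⟨Submodule.inclusion hij, _⟩ _ n`.  Everything is B1
(`ContinuousCohomologyCoefficientColimit.lean`: `Hⁿ_cont(G, ⋃ N i) = ⋃ im Hⁿ(G, N i)` for compact `G`,
`n = 1, 2`) read in this dictionary (`Hmap … = cohomologyMap (TopRep.ofHom ⟨subtypeL, _⟩) …` and
`localRep S ρ_i v = (localRep S ρ v).subrepresentation (N i) _` hold by `rfl`; `Gal(K_Σ/K)` and
`Γ_{K_v}` are compact):

* §1 GLOBAL: `Hⁿ(K_Σ/K, 𝐃) = ⋃_i im h_i` (`exists_Hmap_subtype_eq_one/_two`), dies-deeper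
  (`exists_Hmap_inclusion_eq_zero_one/_two`), transition compatibility (`Hmap_subtype_Hmap_inclusion`);
* §2 LOCAL at every place `v` (`exists_localHmap_subtype_eq_one/_two`, `exists_localHmap_inclusion_eq_zero_one`,
  `localHmap_subtype_localHmap_inclusion`), and `loc_v ∘ h_i = h_{i,v} ∘ loc_v` is the tree's
  `loc_Hmap_subtype_comm`;
* §3 `P(K, 𝐃) = ∏_{v ∈ Σ} H¹(K_v, 𝐃)`: for FINITE `S`, every `t ∈ P(K, 𝐃)` comes from ONE level
  (`exists_level_forall_localHmap_eq`, `[Finite (SigmaPlace S)]` — from `S.Finite` by the tree's `finite_setOf_inSigma`);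
* §4 specifications: for `𝓛` on `𝐃` and level specifications `𝓛ᵢ` on `N i` CHARACTERISED by
  `c ∈ 𝓛ᵢ_v ↔ h_{i,v} c ∈ 𝓛_v` (print's `𝓛`-maximal specification, §3.2 p. 12; hypothesis `hL`,
  no definition made): `h_{i,v}(𝓛ᵢ_v) ≤ 𝓛_v`, the induced `Q_{𝓛ᵢ}(K_v, N i) → Q_𝓛(K_v, 𝐃)` is
  INJECTIVE (`mapQ_injective_of_level`), `φ_𝓛 ∘ h_i = (Q-map) ∘ φ_{𝓛ᵢ}` (`phi_Hmap_subtype`),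
  `Q_𝓛(K, 𝐃) = ⋃ im Q_{𝓛ᵢ}` for finite `S` (`exists_level_forall_mapQ_eq`), and
  **`coker(φ_𝓛) = colim_i coker(φ_{𝓛ᵢ})`** in element form: a level-`i` element of `Q_{𝓛ᵢ}(K, N i)`
  whose image lies in `im φ_𝓛` lies in `im φ_{𝓛_k}` after transition to a deeper level `k`
  (`exists_level_phi_eq_of_mapQ_mem_range`).

HONESTY: book-keeping for the Λ-adic/finite-level passage of Greenberg 2010 §3 (as used in the
road's step (ε)); nothing about Poitou–Tate, SUR or BSD is proved here.  AI formalisation, weaker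
than expert review; the statements are established only by the kernel check.

## References
* R. Greenberg, *Surjectivity of the global-to-local map defining a Selmer group*, Kyoto J. Math.
  50 (2010) 853–888, §3.1–3.2 (pp. 14–15), §4.1. [Greenberg2010]
* R. Greenberg, *On the structure of Selmer groups*, Springer PROMS 188 (2016), §3.2 p. 12
  (the `𝓛`-maximal specification for a submodule). [Greenberg2016Selmer]
* J.-P. Serre, *Galois Cohomology* (1997), I §2.2 Prop. 8. [SerreGaloisCohomology1997]
-/

noncomputable section

open CategoryTheory Function Set NumberField IsDedekindDomain Field
open Literature.NumberTheory.GaloisRepresentations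

namespace Literature.NumberTheory.IwasawaTheory.Greenberg2016

variable {K : Type} [Field K] [NumberField K] (S : Set (HeightOneSpectrum (𝓞 K)))
  {Λ : Type} [CommRing Λ] [TopologicalSpace Λ]
  {D : Type} [AddCommGroup D] [Module Λ D] [TopologicalSpace D] [DiscreteTopology D]
  [ContinuousSMul Λ D]
  (ρ : ContinuousRep (GaloisGroupUnramifiedOutside K S) Λ D)
  {ι : Type*} (N : ι → Submodule Λ D)
  (hN : ∀ (i : ι) (g : GaloisGroupUnramifiedOutside K S), N i ≤ (N i).comap (ρ g))

/-! ### §1. Global cohomology `Hⁿ(K_Σ/K, 𝐃) = ⋃ im Hⁿ(K_Σ/K, N i)`, `n = 1, 2` -/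

section Global

/-- **`H¹(K_Σ/K, 𝐃) = ⋃_i im H¹(K_Σ/K, N i)`** for an exhaustive directed family of stable submodules
(`Gal(K_Σ/K)` compact, `𝐃` discrete; B1 in the dictionary's `Hmap` currency).
[cite: SerreGaloisCohomology1997, I §2.2 Prop. 8] -/
theorem exists_Hmap_subtype_eq_one (hdir : Directed (· ≤ ·) N) (hex : ∀ d : D, ∃ i, d ∈ N i)
    (x : ρ.H 1) :
    ∃ (i : ι) (y : (ρ.subrepresentation (N i) (hN i)).H 1),
      Hmap (ρ.subrepresentation (N i) (hN i)) ρ (N i).subtypeL (fun _ _ ↦ rfl) 1 y = x := by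
  obtain ⟨i, y, hy⟩ := ρ.exists_cohomologyMap_eq_one N hN hdir hex x
  exact ⟨i, y, hy (TopRep.ofHom ⟨(N i).subtypeL, fun g ↦ by ext; rfl⟩) fun _ ↦ rfl⟩

/-- **`H²(K_Σ/K, 𝐃) = ⋃_i im H²(K_Σ/K, N i)`** (idem, degree `2`).
[cite: SerreGaloisCohomology1997, I §2.2 Prop. 8] -/
theorem exists_Hmap_subtype_eq_two (hdir : Directed (· ≤ ·) N) (hex : ∀ d : D, ∃ i, d ∈ N i)
    (x : ρ.H 2) :
    ∃ (i : ι) (y : (ρ.subrepresentation (N i) (hN i)).H 2),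
      Hmap (ρ.subrepresentation (N i) (hN i)) ρ (N i).subtypeL (fun _ _ ↦ rfl) 2 y = x := by
  obtain ⟨i, y, hy⟩ := ρ.exists_cohomologyMap_eq_two N hN hdir hex x
  exact ⟨i, y, hy (TopRep.ofHom ⟨(N i).subtypeL, fun g ↦ by ext; rfl⟩) fun _ ↦ rfl⟩

omit [NumberField K] in
/-- **Dies-deeper, degree `1`**: a class of `H¹(K_Σ/K, N i)` vanishing in `H¹(K_Σ/K, 𝐃)` vanishes in
`H¹(K_Σ/K, N j)` for some `N j ⊇ N i`. [cite: SerreGaloisCohomology1997, I §2.2 Prop. 8] -/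
theorem exists_Hmap_inclusion_eq_zero_one (hdir : Directed (· ≤ ·) N)
    (hex : ∀ d : D, ∃ i, d ∈ N i) {i : ι} (y : (ρ.subrepresentation (N i) (hN i)).H 1)
    (hy : Hmap (ρ.subrepresentation (N i) (hN i)) ρ (N i).subtypeL (fun _ _ ↦ rfl) 1 y = 0) :
    ∃ (j : ι) (hij : N i ≤ N j),
      Hmap (ρ.subrepresentation (N i) (hN i)) (ρ.subrepresentation (N j) (hN j))
        ⟨Submodule.inclusion hij, continuous_of_discreteTopology⟩ (fun _ _ ↦ rfl) 1 y = 0 := by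
  obtain ⟨j, hij, hj⟩ := ρ.exists_cohomologyMap_eq_zero_one N hN hdir hex y
    (TopRep.ofHom ⟨(N i).subtypeL, fun g ↦ by ext; rfl⟩) (fun _ ↦ rfl) hy
  exact ⟨j, hij, hj (TopRep.ofHom ⟨⟨Submodule.inclusion hij, continuous_of_discreteTopology⟩,
    fun g ↦ by ext; rfl⟩) fun _ ↦ rfl⟩

/-- **Dies-deeper, degree `2`.** [cite: SerreGaloisCohomology1997, I §2.2 Prop. 8] -/
theorem exists_Hmap_inclusion_eq_zero_two (hdir : Directed (· ≤ ·) N)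
    (hex : ∀ d : D, ∃ i, d ∈ N i) {i : ι} (y : (ρ.subrepresentation (N i) (hN i)).H 2)
    (hy : Hmap (ρ.subrepresentation (N i) (hN i)) ρ (N i).subtypeL (fun _ _ ↦ rfl) 2 y = 0) :
    ∃ (j : ι) (hij : N i ≤ N j),
      Hmap (ρ.subrepresentation (N i) (hN i)) (ρ.subrepresentation (N j) (hN j))
        ⟨Submodule.inclusion hij, continuous_of_discreteTopology⟩ (fun _ _ ↦ rfl) 2 y = 0 := by
  obtain ⟨j, hij, hj⟩ := ρ.exists_cohomologyMap_eq_zero_two N hN hdir hex y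
    (TopRep.ofHom ⟨(N i).subtypeL, fun g ↦ by ext; rfl⟩) (fun _ ↦ rfl) hy
  exact ⟨j, hij, hj (TopRep.ofHom ⟨⟨Submodule.inclusion hij, continuous_of_discreteTopology⟩,
    fun g ↦ by ext; rfl⟩) fun _ ↦ rfl⟩

/-- **Transition compatibility `h_j ∘ (N i ↪ N j) = h_i` on `Hⁿ(K_Σ/K, ·)`, `n = 1, 2`.**
[cite: SerreGaloisCohomology1997, I §2.4] -/
theorem Hmap_subtype_Hmap_inclusion {i j : ι} (hij : N i ≤ N j) (n : ℕ) (hn : n = 1 ∨ n = 2)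
    (y : (ρ.subrepresentation (N i) (hN i)).H n) :
    Hmap (ρ.subrepresentation (N j) (hN j)) ρ (N j).subtypeL (fun _ _ ↦ rfl) n
      (Hmap (ρ.subrepresentation (N i) (hN i)) (ρ.subrepresentation (N j) (hN j))
        ⟨Submodule.inclusion hij, continuous_of_discreteTopology⟩ (fun _ _ ↦ rfl) n y) =
    Hmap (ρ.subrepresentation (N i) (hN i)) ρ (N i).subtypeL (fun _ _ ↦ rfl) n y := by
  rcases hn with rfl | rfl
  · exact ContinuousRep.cohomologyMap_comp_apply_of_eq_one
      (TopRep.ofHom ⟨⟨Submodule.inclusion hij, continuous_of_discreteTopology⟩, fun g ↦ by ext; rfl⟩)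
      (TopRep.ofHom ⟨(N j).subtypeL, fun g ↦ by ext; rfl⟩)
      (TopRep.ofHom ⟨(N i).subtypeL, fun g ↦ by ext; rfl⟩) (fun _ ↦ rfl) y
  · exact ContinuousRep.cohomologyMap_comp_apply_of_eq_two
      (TopRep.ofHom ⟨⟨Submodule.inclusion hij, continuous_of_discreteTopology⟩, fun g ↦ by ext; rfl⟩)
      (TopRep.ofHom ⟨(N j).subtypeL, fun g ↦ by ext; rfl⟩)
      (TopRep.ofHom ⟨(N i).subtypeL, fun g ↦ by ext; rfl⟩) (fun _ ↦ rfl) y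

/-- **Transitions compose: `(N j ↪ N k) ∘ (N i ↪ N j) = (N i ↪ N k)` on `Hⁿ(K_Σ/K, ·)`, `n = 1, 2`.**
[cite: SerreGaloisCohomology1997, I §2.4] -/
theorem Hmap_inclusion_Hmap_inclusion {i j k : ι} (hij : N i ≤ N j) (hjk : N j ≤ N k) (n : ℕ)
    (hn : n = 1 ∨ n = 2) (y : (ρ.subrepresentation (N i) (hN i)).H n) :
    Hmap (ρ.subrepresentation (N j) (hN j)) (ρ.subrepresentation (N k) (hN k))
        ⟨Submodule.inclusion hjk, continuous_of_discreteTopology⟩ (fun _ _ ↦ rfl) n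
      (Hmap (ρ.subrepresentation (N i) (hN i)) (ρ.subrepresentation (N j) (hN j))
        ⟨Submodule.inclusion hij, continuous_of_discreteTopology⟩ (fun _ _ ↦ rfl) n y) =
    Hmap (ρ.subrepresentation (N i) (hN i)) (ρ.subrepresentation (N k) (hN k))
        ⟨Submodule.inclusion (hij.trans hjk), continuous_of_discreteTopology⟩ (fun _ _ ↦ rfl) n y := by
  rcases hn with rfl | rfl
  · exact ContinuousRep.cohomologyMap_comp_apply_of_eq_one
      (TopRep.ofHom ⟨⟨Submodule.inclusion hij, continuous_of_discreteTopology⟩, fun g ↦ by ext; rfl⟩)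
      (TopRep.ofHom ⟨⟨Submodule.inclusion hjk, continuous_of_discreteTopology⟩, fun g ↦ by ext; rfl⟩)
      (TopRep.ofHom ⟨⟨Submodule.inclusion (hij.trans hjk), continuous_of_discreteTopology⟩,
        fun g ↦ by ext; rfl⟩) (fun _ ↦ rfl) y
  · exact ContinuousRep.cohomologyMap_comp_apply_of_eq_two
      (TopRep.ofHom ⟨⟨Submodule.inclusion hij, continuous_of_discreteTopology⟩, fun g ↦ by ext; rfl⟩)
      (TopRep.ofHom ⟨⟨Submodule.inclusion hjk, continuous_of_discreteTopology⟩, fun g ↦ by ext; rfl⟩)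
      (TopRep.ofHom ⟨⟨Submodule.inclusion (hij.trans hjk), continuous_of_discreteTopology⟩,
        fun g ↦ by ext; rfl⟩) (fun _ ↦ rfl) y

end Global

/-! ### §2. Local cohomology `Hⁿ(K_v, 𝐃) = ⋃ im Hⁿ(K_v, N i)` at every place `v` -/

section Local

/-- **`H¹(K_v, 𝐃) = ⋃_i im H¹(K_v, N i)`** at every place `v` (`Γ_{K_v}` compact; `localRep S ρ_i v`
is the restriction of `localRep S ρ v` to `N i`, definitionally). [cite: SerreGaloisCohomology1997, I §2.2 Prop. 8] -/
theorem exists_localHmap_subtype_eq_one (hdir : Directed (· ≤ ·) N) (hex : ∀ d : D, ∃ i, d ∈ N i)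
    (v : Place K) (x : (localRep S ρ v).H 1) :
    ∃ (i : ι) (y : (localRep S (ρ.subrepresentation (N i) (hN i)) v).H 1),
      Hmap (localRep S (ρ.subrepresentation (N i) (hN i)) v) (localRep S ρ v) (N i).subtypeL
        (fun _ _ ↦ rfl) 1 y = x := by
  haveI : CompactSpace (absoluteGaloisGroup v.Completion) := absoluteGaloisGroup_compactSpace _
  obtain ⟨i, y, hy⟩ :=
    (localRep S ρ v).exists_cohomologyMap_eq_one N (fun i _ ↦ hN i _) hdir hex x
  exact ⟨i, y, hy (TopRep.ofHom ⟨(N i).subtypeL, fun g ↦ by ext; rfl⟩) fun _ ↦ rfl⟩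

/-- **`H²(K_v, 𝐃) = ⋃_i im H²(K_v, N i)`** at every place `v`.
[cite: SerreGaloisCohomology1997, I §2.2 Prop. 8] -/
theorem exists_localHmap_subtype_eq_two (hdir : Directed (· ≤ ·) N) (hex : ∀ d : D, ∃ i, d ∈ N i)
    (v : Place K) (x : (localRep S ρ v).H 2) :
    ∃ (i : ι) (y : (localRep S (ρ.subrepresentation (N i) (hN i)) v).H 2),
      Hmap (localRep S (ρ.subrepresentation (N i) (hN i)) v) (localRep S ρ v) (N i).subtypeL
        (fun _ _ ↦ rfl) 2 y = x := by
  haveI : CompactSpace (absoluteGaloisGroup v.Completion) := absoluteGaloisGroup_compactSpace _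
  obtain ⟨i, y, hy⟩ :=
    (localRep S ρ v).exists_cohomologyMap_eq_two N (fun i _ ↦ hN i _) hdir hex x
  exact ⟨i, y, hy (TopRep.ofHom ⟨(N i).subtypeL, fun g ↦ by ext; rfl⟩) fun _ ↦ rfl⟩

/-- **Local dies-deeper, degree `1`.** [cite: SerreGaloisCohomology1997, I §2.2 Prop. 8] -/
theorem exists_localHmap_inclusion_eq_zero_one (hdir : Directed (· ≤ ·) N)
    (hex : ∀ d : D, ∃ i, d ∈ N i) (v : Place K) {i : ι}
    (y : (localRep S (ρ.subrepresentation (N i) (hN i)) v).H 1)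
    (hy : Hmap (localRep S (ρ.subrepresentation (N i) (hN i)) v) (localRep S ρ v) (N i).subtypeL
      (fun _ _ ↦ rfl) 1 y = 0) :
    ∃ (j : ι) (hij : N i ≤ N j),
      Hmap (localRep S (ρ.subrepresentation (N i) (hN i)) v)
        (localRep S (ρ.subrepresentation (N j) (hN j)) v)
        ⟨Submodule.inclusion hij, continuous_of_discreteTopology⟩ (fun _ _ ↦ rfl) 1 y = 0 := by
  obtain ⟨j, hij, hj⟩ := (localRep S ρ v).exists_cohomologyMap_eq_zero_one N (fun i _ ↦ hN i _)
    hdir hex y (TopRep.ofHom ⟨(N i).subtypeL, fun g ↦ by ext; rfl⟩) (fun _ ↦ rfl) hy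
  exact ⟨j, hij, hj (TopRep.ofHom ⟨⟨Submodule.inclusion hij, continuous_of_discreteTopology⟩,
    fun g ↦ by ext; rfl⟩) fun _ ↦ rfl⟩

/-- **Local transition compatibility `h_{j,v} ∘ (N i ↪ N j) = h_{i,v}`, `n = 1, 2`.**
[cite: SerreGaloisCohomology1997, I §2.4] -/
theorem localHmap_subtype_localHmap_inclusion (v : Place K) {i j : ι} (hij : N i ≤ N j) (n : ℕ)
    (hn : n = 1 ∨ n = 2) (y : (localRep S (ρ.subrepresentation (N i) (hN i)) v).H n) :
    Hmap (localRep S (ρ.subrepresentation (N j) (hN j)) v) (localRep S ρ v) (N j).subtypeL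
        (fun _ _ ↦ rfl) n
      (Hmap (localRep S (ρ.subrepresentation (N i) (hN i)) v)
        (localRep S (ρ.subrepresentation (N j) (hN j)) v)
        ⟨Submodule.inclusion hij, continuous_of_discreteTopology⟩ (fun _ _ ↦ rfl) n y) =
    Hmap (localRep S (ρ.subrepresentation (N i) (hN i)) v) (localRep S ρ v) (N i).subtypeL
        (fun _ _ ↦ rfl) n y := by
  haveI : CompactSpace (absoluteGaloisGroup v.Completion) := absoluteGaloisGroup_compactSpace _
  rcases hn with rfl | rfl
  · exact (localRep S ρ v).cohomologyMap_comp_apply_of_eq_one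
      (σ := (localRep S ρ v).subrepresentation (N i) (fun _ ↦ hN i _))
      (σ' := (localRep S ρ v).subrepresentation (N j) (fun _ ↦ hN j _))
      (TopRep.ofHom ⟨⟨Submodule.inclusion hij, continuous_of_discreteTopology⟩, fun g ↦ by ext; rfl⟩)
      (TopRep.ofHom ⟨(N j).subtypeL, fun g ↦ by ext; rfl⟩)
      (TopRep.ofHom ⟨(N i).subtypeL, fun g ↦ by ext; rfl⟩) (fun _ ↦ rfl) y
  · exact (localRep S ρ v).cohomologyMap_comp_apply_of_eq_two
      (σ := (localRep S ρ v).subrepresentation (N i) (fun _ ↦ hN i _))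
      (σ' := (localRep S ρ v).subrepresentation (N j) (fun _ ↦ hN j _))
      (TopRep.ofHom ⟨⟨Submodule.inclusion hij, continuous_of_discreteTopology⟩, fun g ↦ by ext; rfl⟩)
      (TopRep.ofHom ⟨(N j).subtypeL, fun g ↦ by ext; rfl⟩)
      (TopRep.ofHom ⟨(N i).subtypeL, fun g ↦ by ext; rfl⟩) (fun _ ↦ rfl) y

end Local

/-! ### §3. `P(K, 𝐃) = ∏_{v ∈ Σ} H¹(K_v, 𝐃)`: a common level for finitely many places -/

section Product

/-- **For finite `Σ`, every `t ∈ P(K, 𝐃) = ∏_{v ∈ Σ} H¹(K_v, 𝐃)` comes from ONE level**: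
`t_v = h_{i,v}(t'_v)` for all `v ∈ Σ` with a single `i` (finitely many places, each handled by
§2, then a common upper bound in the directed family). This is the first step of Greenberg 2010
§3's passage to finite levels. [cite: Greenberg2010, §3.1 p. 14] -/
theorem exists_level_forall_localHmap_eq [Finite (SigmaPlace S)] (hdir : Directed (· ≤ ·) N)
    (hex : ∀ d : D, ∃ i, d ∈ N i) (t : ∀ v : SigmaPlace S, (localRep S ρ v.1).H 1) :
    ∃ (i : ι) (t' : ∀ v : SigmaPlace S, (localRep S (ρ.subrepresentation (N i) (hN i)) v.1).H 1),
      ∀ v : SigmaPlace S, Hmap (localRep S (ρ.subrepresentation (N i) (hN i)) v.1) (localRep S ρ v.1)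
        (N i).subtypeL (fun _ _ ↦ rfl) 1 (t' v) = t v := by
  classical
  haveI : Fintype (SigmaPlace S) := Fintype.ofFinite _
  haveI : Nonempty ι := ⟨(hex 0).choose⟩
  choose iv yv hyv using fun v : SigmaPlace S ↦
    exists_localHmap_subtype_eq_one S ρ N hN hdir hex v.1 (t v)
  obtain ⟨i, hi⟩ := hdir.finset_le (Finset.univ.image iv)
  have hle : ∀ v, N (iv v) ≤ N i := fun v ↦ hi _ (Finset.mem_image_of_mem iv (Finset.mem_univ v))
  exact ⟨i, fun v ↦ Hmap (localRep S (ρ.subrepresentation (N (iv v)) (hN (iv v))) v.1)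
    (localRep S (ρ.subrepresentation (N i) (hN i)) v.1)
    ⟨Submodule.inclusion (hle v), continuous_of_discreteTopology⟩ (fun _ _ ↦ rfl) 1 (yv v),
    fun v ↦ (localHmap_subtype_localHmap_inclusion S ρ N hN v.1 (hle v) 1 (Or.inl rfl)
      (yv v)).trans (hyv v)⟩

end Product

/-! ### §4. Specifications: `Q_𝓛`, `φ_𝓛` and `coker(φ_𝓛)` through the levels -/

section Spec

variable {S ρ N hN}

/-- For a level specification `𝓛ᵢ` characterised by `c ∈ 𝓛ᵢ_v ↔ h_{i,v} c ∈ 𝓛_v` (print's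
`𝓛`-maximal specification for the submodule `N i`), **`h_{i,v}(𝓛ᵢ_v) ≤ 𝓛_v`**.
[cite: Greenberg2016Selmer, §3.2 p. 12] -/
theorem Hmap_mem_of_level {L : Specification S ρ} {i : ι}
    {Li : Specification S (ρ.subrepresentation (N i) (hN i))}
    (hL : ∀ (v : Place K) (c : (localRep S (ρ.subrepresentation (N i) (hN i)) v).H 1),
      c ∈ Li v ↔ Hmap (localRep S (ρ.subrepresentation (N i) (hN i)) v) (localRep S ρ v)
        (N i).subtypeL (fun _ _ ↦ rfl) 1 c ∈ L v)
    (v : Place K) {c : (localRep S (ρ.subrepresentation (N i) (hN i)) v).H 1} (hc : c ∈ Li v) :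
    Hmap (localRep S (ρ.subrepresentation (N i) (hN i)) v) (localRep S ρ v) (N i).subtypeL
      (fun _ _ ↦ rfl) 1 c ∈ L v :=
  (hL v c).1 hc

/-- **The induced map `Q_{𝓛ᵢ}(K_v, N i) → Q_𝓛(K_v, 𝐃)` is injective** when `𝓛ᵢ_v` is the full
preimage of `𝓛_v` (Greenberg 2016 §3.2: `Q_{𝓛_Π}(K_v, 𝐃[π]) ↪ Q_𝓛(K_v, 𝐃)`).
[cite: Greenberg2016Selmer, §3.2 p. 12] -/
theorem mapQ_injective_of_level {L : Specification S ρ} {i : ι}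
    {Li : Specification S (ρ.subrepresentation (N i) (hN i))}
    (hL : ∀ (v : Place K) (c : (localRep S (ρ.subrepresentation (N i) (hN i)) v).H 1),
      c ∈ Li v ↔ Hmap (localRep S (ρ.subrepresentation (N i) (hN i)) v) (localRep S ρ v)
        (N i).subtypeL (fun _ _ ↦ rfl) 1 c ∈ L v)
    (v : Place K) :
    Function.Injective (Submodule.mapQ (Li v) (L v)
      (Hmap (localRep S (ρ.subrepresentation (N i) (hN i)) v) (localRep S ρ v) (N i).subtypeL
        (fun _ _ ↦ rfl) 1) fun c hc ↦ (hL v c).1 hc) := by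
  rw [injective_iff_map_eq_zero]
  intro q hq
  obtain ⟨c, rfl⟩ := (Li v).mkQ_surjective q
  rw [Submodule.mkQ_apply, Submodule.mapQ_apply, Submodule.Quotient.mk_eq_zero] at hq
  rw [Submodule.mkQ_apply, Submodule.Quotient.mk_eq_zero]
  exact (hL v c).2 hq

/-- **`φ_𝓛 ∘ h_i = (Q_{𝓛ᵢ} → Q_𝓛) ∘ φ_{𝓛ᵢ}`**: the global-to-local maps of the levels are
compatible (`loc_v ∘ h_i = h_{i,v} ∘ loc_v`, the tree's `loc_Hmap_subtype_comm`).
[cite: Greenberg2016Selmer, §3.2 p. 12 L10–14] -/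
theorem phi_Hmap_subtype {L : Specification S ρ} {i : ι}
    {Li : Specification S (ρ.subrepresentation (N i) (hN i))}
    (hL : ∀ (v : Place K) (c : (localRep S (ρ.subrepresentation (N i) (hN i)) v).H 1),
      c ∈ Li v ↔ Hmap (localRep S (ρ.subrepresentation (N i) (hN i)) v) (localRep S ρ v)
        (N i).subtypeL (fun _ _ ↦ rfl) 1 c ∈ L v)
    (c : (ρ.subrepresentation (N i) (hN i)).H 1) (v : SigmaPlace S) :
    L.phi (Hmap (ρ.subrepresentation (N i) (hN i)) ρ (N i).subtypeL (fun _ _ ↦ rfl) 1 c) v =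
      Submodule.mapQ (Li v.1) (L v.1)
        (Hmap (localRep S (ρ.subrepresentation (N i) (hN i)) v.1) (localRep S ρ v.1) (N i).subtypeL
          (fun _ _ ↦ rfl) 1) (fun c hc ↦ (hL v.1 c).1 hc) (Li.phi c v) := by
  rw [Specification.phi_apply, Specification.phi_apply, Submodule.mapQ_apply,
    loc_Hmap_subtype_comm]

variable (S ρ N hN) in
/-- Level specifications characterised as preimages of `𝓛` are compatible with the transitions:
`(N i ↪ N k)_* 𝓛ᵢ_v ≤ 𝓛_k_v`. [cite: Greenberg2016Selmer, §3.2 p. 12] -/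
theorem Hmap_inclusion_mem_level {L : Specification S ρ}
    {Lv : ∀ i, Specification S (ρ.subrepresentation (N i) (hN i))}
    (hL : ∀ (i : ι) (v : Place K) (c : (localRep S (ρ.subrepresentation (N i) (hN i)) v).H 1),
      c ∈ Lv i v ↔ Hmap (localRep S (ρ.subrepresentation (N i) (hN i)) v) (localRep S ρ v)
        (N i).subtypeL (fun _ _ ↦ rfl) 1 c ∈ L v)
    {i k : ι} (hik : N i ≤ N k) (v : Place K)
    (c : (localRep S (ρ.subrepresentation (N i) (hN i)) v).H 1) (hc : c ∈ Lv i v) :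
    Hmap (localRep S (ρ.subrepresentation (N i) (hN i)) v)
        (localRep S (ρ.subrepresentation (N k) (hN k)) v)
        ⟨Submodule.inclusion hik, continuous_of_discreteTopology⟩ (fun _ _ ↦ rfl) 1 c ∈ Lv k v := by
  rw [hL k, localHmap_subtype_localHmap_inclusion S ρ N hN v hik 1 (Or.inl rfl)]
  exact (hL i v c).1 hc

variable (S ρ N hN) in
/-- **`Q_𝓛(K, 𝐃) = ⋃_i im Q_{𝓛ᵢ}(K, N i)`** for finite `S`: every `q ∈ Q_𝓛(K, 𝐃)` is the image of
some `q' ∈ Q_{𝓛ᵢ}(K, N i)` at ONE level `i`, for any family of level specifications `𝓛ᵢ`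
characterised as above. [cite: Greenberg2010, §3.1 p. 14] -/
theorem exists_level_forall_mapQ_eq [Finite (SigmaPlace S)] (hdir : Directed (· ≤ ·) N)
    (hex : ∀ d : D, ∃ i, d ∈ N i) (L : Specification S ρ)
    (Lv : ∀ i, Specification S (ρ.subrepresentation (N i) (hN i)))
    (hL : ∀ (i : ι) (v : Place K) (c : (localRep S (ρ.subrepresentation (N i) (hN i)) v).H 1),
      c ∈ Lv i v ↔ Hmap (localRep S (ρ.subrepresentation (N i) (hN i)) v) (localRep S ρ v)
        (N i).subtypeL (fun _ _ ↦ rfl) 1 c ∈ L v)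
    (q : L.QGlobal) :
    ∃ (i : ι) (q' : (Lv i).QGlobal), ∀ v : SigmaPlace S,
      Submodule.mapQ (Lv i v.1) (L v.1)
        (Hmap (localRep S (ρ.subrepresentation (N i) (hN i)) v.1) (localRep S ρ v.1) (N i).subtypeL
          (fun _ _ ↦ rfl) 1) (fun c hc ↦ (hL i v.1 c).1 hc) (q' v) = q v := by
  choose t ht using fun v : SigmaPlace S ↦ (L v.1).mkQ_surjective (q v)
  obtain ⟨i, t', ht'⟩ := exists_level_forall_localHmap_eq S ρ N hN hdir hex t
  refine ⟨i, fun v ↦ Submodule.Quotient.mk (t' v), fun v ↦ ?_⟩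
  dsimp only
  rw [Submodule.mapQ_apply, ht']
  exact ht v

variable (S ρ N hN) in
/-- **`coker(φ_𝓛) = colim_i coker(φ_{𝓛ᵢ})`, the vanishing half**: if a level-`i` element
`q' ∈ Q_{𝓛ᵢ}(K, N i)` maps into `im φ_𝓛` in `Q_𝓛(K, 𝐃)`, then after transition to some deeper level
`k ⊇ N i` it lies in `im φ_{𝓛_k}` (the global class comes from some level, the two level images agree
in `Q_𝓛`, and `Q_{𝓛_k} ↪ Q_𝓛` is injective). With `exists_level_forall_mapQ_eq` this is
`coker(φ_𝓛) = colim coker(φ_{𝓛ᵢ})` in element form (filtered colimits are exact) — the book-keeping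
of Greenberg 2010 §3's passage between `𝐃` and its finite levels.
[cite: Greenberg2010, §3.1–3.2 pp. 14–15] -/
theorem exists_level_phi_eq_of_mapQ_mem_range (hdir : Directed (· ≤ ·) N)
    (hex : ∀ d : D, ∃ i, d ∈ N i) (L : Specification S ρ)
    (Lv : ∀ i, Specification S (ρ.subrepresentation (N i) (hN i)))
    (hL : ∀ (i : ι) (v : Place K) (c : (localRep S (ρ.subrepresentation (N i) (hN i)) v).H 1),
      c ∈ Lv i v ↔ Hmap (localRep S (ρ.subrepresentation (N i) (hN i)) v) (localRep S ρ v)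
        (N i).subtypeL (fun _ _ ↦ rfl) 1 c ∈ L v)
    {i : ι} (q' : (Lv i).QGlobal) (x : ρ.H 1)
    (hq : ∀ v : SigmaPlace S, Submodule.mapQ (Lv i v.1) (L v.1)
        (Hmap (localRep S (ρ.subrepresentation (N i) (hN i)) v.1) (localRep S ρ v.1) (N i).subtypeL
          (fun _ _ ↦ rfl) 1) (fun c hc ↦ (hL i v.1 c).1 hc) (q' v) = L.phi x v) :
    ∃ (k : ι) (hik : N i ≤ N k) (xk : (ρ.subrepresentation (N k) (hN k)).H 1),
      Hmap (ρ.subrepresentation (N k) (hN k)) ρ (N k).subtypeL (fun _ _ ↦ rfl) 1 xk = x ∧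
      ∀ v : SigmaPlace S, Submodule.mapQ (Lv i v.1) (Lv k v.1)
          (Hmap (localRep S (ρ.subrepresentation (N i) (hN i)) v.1)
            (localRep S (ρ.subrepresentation (N k) (hN k)) v.1)
            ⟨Submodule.inclusion hik, continuous_of_discreteTopology⟩ (fun _ _ ↦ rfl) 1)
          (fun c hc ↦ Hmap_inclusion_mem_level S ρ N hN hL hik v.1 c hc) (q' v) =
        (Lv k).phi xk v := by
  -- the global class comes from some level `i'`; go to a common level `k`
  obtain ⟨i', x', rfl⟩ := exists_Hmap_subtype_eq_one S ρ N hN hdir hex x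
  obtain ⟨k, hik, hi'k⟩ := hdir i i'
  refine ⟨k, hik, Hmap (ρ.subrepresentation (N i') (hN i')) (ρ.subrepresentation (N k) (hN k))
    ⟨Submodule.inclusion hi'k, continuous_of_discreteTopology⟩ (fun _ _ ↦ rfl) 1 x',
    Hmap_subtype_Hmap_inclusion S ρ N hN hi'k 1 (Or.inl rfl) x', fun v ↦ ?_⟩
  -- both sides have the same image under the INJECTIVE `Q_{𝓛_k} → Q_𝓛`
  apply mapQ_injective_of_level (hL k) v.1
  obtain ⟨c, hc⟩ := (Lv i v.1).mkQ_surjective (q' v)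
  have h1 := hq v
  rw [← hc, Submodule.mkQ_apply, Submodule.mapQ_apply] at h1
  rw [← phi_Hmap_subtype (hL k), Hmap_subtype_Hmap_inclusion S ρ N hN hi'k 1 (Or.inl rfl), ← hc,
    Submodule.mkQ_apply, Submodule.mapQ_apply, Submodule.mapQ_apply,
    localHmap_subtype_localHmap_inclusion S ρ N hN v.1 hik 1 (Or.inl rfl)]
  exact h1

end Spec

end Literature.NumberTheory.IwasawaTheory.Greenberg2016
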